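import Summits.CriticalPhenomena.PercolationContinuityZ3.Theses.PercNonSelfAveraging
import Summits.CriticalPhenomena.PercolationContinuityZ3.Theses.PercNonProliferation
import Summits.CriticalPhenomena.PercolationContinuityZ3.Theorems.PercNonSelfAveragingLowerTailLadder
import Summits.CriticalPhenomena.PercolationContinuityZ3.Theorems.PercNonSelfAveragingStrictFKGLadder
import Summits.CriticalPhenomena.PercolationContinuityZ3.Theorems.PercNonProliferationMeanCauchySchwarz
import HarnessLib

/-!
# `PercNonSelfAveraging.ArmMassNSAOfSplit` (stmt-CriticalPhenomena-18330), settled: the split of the crux `ArmMassNSA`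
# (stmt-CriticalPhenomena-7058) along the spanning clusters — `ClusterMassAnticoncentration → NonProliferation → ArmMassNSA`

Landed by the RSW3 lane (prover P2, gen 31) from the crux-strategist's registered line
`Cruxes/ArmMassNSA/Lines/split_nonproliferation.lean` (cstrat-7058), stubs removed; nothing here uses p205010.

Composition `armMassNSAOfSplit_proof` PROVED; the two hypotheses are the route decls `ClusterMassAnticoncentration` (new crux) and
`NonProliferation` (= stmt-CriticalPhenomena-4444 verbatim).

`ArmMassNSA` (stmt-CriticalPhenomena-7058) asks, at `p_c(ℤ³)`, for `Var(M_n) ≥ c (E M_n)²` along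
infinitely many `n`, where `M_n = #{x ∈ B(n) : x ↔ ∂⁻B(2n) inside B(2n)}` is the arm mass of the box.
Group the armed sites of `B(n)` into their open clusters of the configuration restricted to `B(2n)`
(the SPANNING box-clusters: they meet `B(n)` and reach `∂⁻B(2n)`); if `m_C` is the number of sites of
`B(n)` in the spanning cluster `C` and `N_n` the number of spanning clusters, then `M_n = Σ_C m_C` and
the SQUARED CLUSTER MOMENT is `Q_n = Σ_C m_C² = #{(x,y) ∈ B(n)² : x ↔ y ↔ ∂⁻B(2n) inside B(2n)}`.

The decomposition proved here (`armMassNSAOfSplit_proof`):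

* `ClusterMassAnticoncentration` — `∃ c₁ > 0`, for all large `n`,
  `c₁ · E[Q_n] = c₁ · Σ_{x,y ∈ B(n)} P_{p_c}(x ↔ ∂⁻B(2n) and x ↔ y, inside B(2n)) ≤ Var(M_n)`
  (the fluctuations of the total armed mass are at least a fixed fraction of the sum of the squared
  spanning-cluster masses: the BK deficit does not cancel the same-cluster term);
* `NonProliferation` — VERBATIM the crux `PercNonProliferation.NonProliferation`
  (stmt-CriticalPhenomena-4444): `∃ M c > 0`, for infinitely many `n`, with probability `≥ c` there are
  no `M+1` points of `B(n)`, pairwise not joined inside `B(2n)`, each joined inside `B(2n)` to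
  `∂⁻B(2n)` (at most `M` spanning box-clusters);

together imply `ArmMassNSA`.  Proof at a scale `n` where both hold (frequently): let
`E = E M_n`, `G = {N_n ≤ M}`, `H = {M_n > E/2}`.  Either `P(G ∖ H) ≥ c/2`, and then
`P(M_n ≤ E/2) ≥ c/2` gives `Var ≥ (c/8) E²` by Chebyshev read backwards
(`div_four_mul_sq_integral_le_variance_of_lowerTail`); or `P(G ∩ H) ≥ c/2`, and on `G` the
Cauchy–Schwarz inequality over the `≤ M` classes of armed sites gives `M_n² ≤ M · Q_n` pointwise
(`MeanCauchySchwarz.card_sq_le_card_image_mul_sum`, `exists_transversal`), whence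
`(E/2)² · c/2 ≤ E[M_n² ; G ∩ H] ≤ (M+1) E[Q_n]` and `Var ≥ c₁ E[Q_n] ≥ c₁ c E² / (8(M+1))`.
No FKG, BK or independence is used: the split isolates the two classical `d < 6` inputs
(tightness of the number of spanning clusters — Aizenman 1997, Borgs–Chayes–Kesten–Spencer 1999 —
and non-degenerate mass fluctuations of the spanning clusters) whose conjunction is the Binder-ratio
statement `ArmMassNSA`.  The measure-theoretic core is proved for an abstract probability space,
a finite index set `B`, "arm" events `A x` and "connection" events `C x y` forming, for every
sample point, an equivalence relation on `B`.
-/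

noncomputable section

namespace Summit.CriticalPhenomena.PercolationContinuityZ3.Theorems.ArmMassNSASplit

open MeasureTheory ProbabilityTheory Filter
open Literature.Probability.LatticeModels Literature.Probability.Percolation
open scoped Classical

open Summit.CriticalPhenomena.PercolationContinuityZ3.Theorems

namespace Helpers

/-! ### Combinatorics: few classes force `(#armed)² ≤ M · (squared cluster moment)` -/

/-- **Cauchy–Schwarz over at most `M` classes.** Let `r` be reflexive on the finite set `B`,
symmetric and transitive, and `a` a predicate. If there is no family of `M+1` points of `B`
satisfying `a` and pairwise not `r`-related, then
`#{x ∈ B : a x}² ≤ M · Σ_{x ∈ B, a x} #{y ∈ B : r x y}`. [folklore] -/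
theorem card_sq_le_mul_sum_of_not_exists {α : Type*} (B : Finset α) (a : α → Prop)
    (r : α → α → Prop) (M : ℕ) (hrefl : ∀ x ∈ B, r x x) (hsymm : ∀ x y, r x y → r y x)
    (htrans : ∀ x y z, r x y → r y z → r x z)
    (hG : ¬ ∃ f : Fin (M + 1) → α, (∀ i, f i ∈ B) ∧ (∀ i, a (f i)) ∧ ∀ i j, i ≠ j → ¬ r (f i) (f j)) :
    (B.filter a).card ^ 2 ≤ M * ∑ x ∈ B.filter a, (B.filter (r x)).card := by
  set P := B.filter a with hP
  have hreflP : ∀ x ∈ P, r x x := fun x hx => hrefl x (Finset.mem_filter.1 hx).1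
  have hsymmP : ∀ x ∈ P, ∀ y ∈ P, r x y → r y x := fun x _ y _ h => hsymm x y h
  have htransP : ∀ x ∈ P, ∀ y ∈ P, ∀ z ∈ P, r x y → r y z → r x z :=
    fun x _ y _ z _ h h' => htrans x y z h h'
  have hA := MeanCauchySchwarz.card_sq_le_card_image_mul_sum P r hreflP hsymmP htransP
  obtain ⟨f, hfP, hf⟩ := MeanCauchySchwarz.exists_transversal P r hsymmP htransP
  have hK : (P.image fun x => P.filter (r x)).card ≤ M := by
    by_contra hlt
    push Not at hlt
    exact hG ⟨fun i => f (Fin.castLE hlt i), fun i => (Finset.mem_filter.1 (hfP _)).1,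
      fun i => (Finset.mem_filter.1 (hfP _)).2,
      fun i j hij => hf _ _ fun h => hij (Fin.castLE_injective hlt h)⟩
  have hsum : ∑ x ∈ P, (P.filter (r x)).card ≤ ∑ x ∈ P, (B.filter (r x)).card :=
    Finset.sum_le_sum fun x _ =>
      Finset.card_le_card (Finset.filter_subset_filter _ (Finset.filter_subset _ _))
  exact hA.trans (Nat.mul_le_mul hK hsum)

/-! ### The abstract estimate: arm events `A x`, connection events `C x y` -/

section Abstract

variable {Ω ι : Type*} (B : Finset ι) (A : ι → Set Ω) (C : ι → ι → Set Ω)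

/-- The "arm mass" `Σ_{x ∈ B} 1_{A x}` as a cardinality. -/
theorem sum_indicator_eq_card (ω : Ω) :
    ∑ x ∈ B, (A x).indicator (fun _ => (1 : ℝ)) ω = ((B.filter fun x => ω ∈ A x).card : ℝ) := by
  simp only [Set.indicator_apply, Finset.sum_boole]

/-- The "squared cluster moment" `Σ_{x,y ∈ B} 1_{A x ∩ C x y}` as a sum of cardinalities over the
armed indices. -/
theorem sum_sum_indicator_inter_eq (ω : Ω) :
    ∑ x ∈ B, ∑ y ∈ B, (A x ∩ C x y).indicator (fun _ => (1 : ℝ)) ω =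
      ∑ x ∈ B.filter (fun x => ω ∈ A x), ((B.filter fun y => ω ∈ C x y).card : ℝ) := by
  rw [Finset.sum_filter]
  refine Finset.sum_congr rfl fun x _ => ?_
  by_cases hx : ω ∈ A x
  · simp only [Set.indicator_apply, Set.mem_inter_iff, hx, true_and, Finset.sum_boole, if_true]
  · simp only [Set.indicator_apply, Set.mem_inter_iff, hx, false_and, if_false,
      Finset.sum_const_zero]

/-- **Pointwise count.** If, at the sample point `ω`, the relation `ω ∈ C x y` is reflexive on `B`,
symmetric and transitive, and there are no `M+1` indices of `B`, all armed, pairwise unrelated,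
then `(Σ_x 1_{A x}(ω))² ≤ M · Σ_{x,y} 1_{A x ∩ C x y}(ω)`. [folklore] -/
theorem sq_sum_indicator_le (M : ℕ) (ω : Ω) (hrefl : ∀ x ∈ B, ω ∈ C x x)
    (hsymm : ∀ x y, ω ∈ C x y → ω ∈ C y x)
    (htrans : ∀ x y z, ω ∈ C x y → ω ∈ C y z → ω ∈ C x z)
    (hω : ¬ ∃ f : Fin (M + 1) → ι, (∀ i, f i ∈ B) ∧ (∀ i, ω ∈ A (f i)) ∧
      ∀ i j, i ≠ j → ω ∉ C (f i) (f j)) :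
    (∑ x ∈ B, (A x).indicator (fun _ => (1 : ℝ)) ω) ^ 2 ≤
      M * ∑ x ∈ B, ∑ y ∈ B, (A x ∩ C x y).indicator (fun _ => (1 : ℝ)) ω := by
  rw [sum_indicator_eq_card, sum_sum_indicator_inter_eq]
  have h := card_sq_le_mul_sum_of_not_exists B (fun x => ω ∈ A x) (fun x y => ω ∈ C x y) M
    hrefl hsymm htrans hω
  exact_mod_cast h

variable [MeasurableSpace Ω] (μ : Measure Ω) [IsProbabilityMeasure μ]

/-- `E[Σ_{x,y} 1_{A x ∩ C x y}] = Σ_{x,y} P(A x ∩ C x y)`. -/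
theorem integral_sum_sum_indicator_inter (hA : ∀ x, MeasurableSet (A x))
    (hC : ∀ x y, MeasurableSet (C x y)) :
    ∫ ω, (∑ x ∈ B, ∑ y ∈ B, (A x ∩ C x y).indicator (fun _ => (1 : ℝ)) ω) ∂μ =
      ∑ x ∈ B, ∑ y ∈ B, μ.real (A x ∩ C x y) := by
  rw [integral_finsetSum _ fun x _ => ?_]
  · refine Finset.sum_congr rfl fun x _ => ?_
    exact integral_sum_indicator_one μ B _ fun y _ => (hA x).inter (hC x y)
  · exact integrable_finsetSum _ fun y _ =>
      (integrable_const (1 : ℝ)).indicator ((hA x).inter (hC x y))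

/-- **The two-case estimate (abstract form).** For a probability measure, measurable arm events
`A x` and connection events `C x y` (`x, y ∈ B`) forming at every sample point an equivalence
relation on `B`, a measurable event `G ⊆ {no M+1 armed pairwise-unrelated indices}` with
`P(G) ≥ c > 0`, and `c₁ Σ_{x,y} P(A x ∩ C x y) ≤ Var(Σ_x 1_{A x})` (`c₁ > 0`):
`(min c₁ 1) c / (8(M+1)) · (E Σ_x 1_{A x})² ≤ Var(Σ_x 1_{A x})`.  Either `{mass ≤ E/2}` has
probability `≥ c/2` (Chebyshev backwards) or `G ∩ {mass > E/2}` does, and there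
`mass² ≤ M · (squared cluster moment)` pointwise. [folklore] -/
theorem variance_lower_of_fewClusters (hA : ∀ x, MeasurableSet (A x))
    (hC : ∀ x y, MeasurableSet (C x y)) (hrefl : ∀ x ∈ B, ∀ ω, ω ∈ C x x)
    (hsymm : ∀ x y ω, ω ∈ C x y → ω ∈ C y x)
    (htrans : ∀ x y z ω, ω ∈ C x y → ω ∈ C y z → ω ∈ C x z)
    (M : ℕ) {G : Set Ω} (hGm : MeasurableSet G)
    (hGsub : G ⊆ {ω | ¬ ∃ f : Fin (M + 1) → ι, (∀ i, f i ∈ B) ∧ (∀ i, ω ∈ A (f i)) ∧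
      ∀ i j, i ≠ j → ω ∉ C (f i) (f j)})
    {c c₁ : ℝ} (hc : 0 < c) (hc₁ : 0 < c₁) (hG : c ≤ μ.real G)
    (hVar : c₁ * (∑ x ∈ B, ∑ y ∈ B, μ.real (A x ∩ C x y)) ≤
      Var[fun ω => ∑ x ∈ B, (A x).indicator (fun _ => (1 : ℝ)) ω; μ]) :
    min c₁ 1 * c / (8 * (M + 1)) * (∫ ω, (∑ x ∈ B, (A x).indicator (fun _ => (1 : ℝ)) ω) ∂μ) ^ 2 ≤
      Var[fun ω => ∑ x ∈ B, (A x).indicator (fun _ => (1 : ℝ)) ω; μ] := by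
  -- notation
  set mass : Ω → ℝ := fun ω => ∑ x ∈ B, (A x).indicator (fun _ => (1 : ℝ)) ω with hmass
  set sqm : Ω → ℝ := fun ω => ∑ x ∈ B, ∑ y ∈ B, (A x ∩ C x y).indicator (fun _ => (1 : ℝ)) ω
    with hsqm
  set E : ℝ := ∫ ω, mass ω ∂μ with hE
  have hmass0 : ∀ ω, 0 ≤ mass ω := fun ω =>
    Finset.sum_nonneg fun _ _ => Set.indicator_nonneg (fun _ _ => zero_le_one) ω
  have hsqm0 : ∀ ω, 0 ≤ sqm ω := fun ω =>
    Finset.sum_nonneg fun _ _ => Finset.sum_nonneg fun _ _ =>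
      Set.indicator_nonneg (fun _ _ => zero_le_one) ω
  have hE0 : 0 ≤ E := integral_nonneg hmass0
  have hmass_meas : Measurable mass := measurable_sum_indicator_one B A fun x _ => hA x
  have hsqm_int : Integrable sqm μ :=
    integrable_finsetSum _ fun x _ => integrable_finsetSum _ fun y _ =>
      (integrable_const (1 : ℝ)).indicator ((hA x).inter (hC x y))
  have hsqm_mean : ∫ ω, sqm ω ∂μ = ∑ x ∈ B, ∑ y ∈ B, μ.real (A x ∩ C x y) :=
    integral_sum_sum_indicator_inter B A C μ hA hC
  have hmin1 : min c₁ 1 ≤ 1 := min_le_right _ _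
  have hmin0 : 0 < min c₁ 1 := lt_min hc₁ one_pos
  have hminc : min c₁ 1 ≤ c₁ := min_le_left _ _
  have hM0 : (0 : ℝ) ≤ (M : ℝ) := by positivity
  -- the event H = {E/2 < mass}
  set H : Set Ω := {ω | E / 2 < mass ω} with hH
  have hHm : MeasurableSet H := measurableSet_lt measurable_const hmass_meas
  have hsplit : μ.real (G ∩ H) + μ.real (G \ H) = μ.real G := measureReal_inter_add_sdiff hHm
  -- the target constant is dominated by the constant of case (i)
  have hconst1 : min c₁ 1 * c / (8 * (M + 1)) ≤ c / 2 / 4 := by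
    rw [div_le_iff₀ (by positivity)]
    have h1 : min c₁ 1 * c ≤ 1 * c := mul_le_mul_of_nonneg_right hmin1 hc.le
    have h2 : c / 2 / 4 * (8 * ((M : ℝ) + 1)) = c * ((M : ℝ) + 1) := by ring
    rw [h2]
    nlinarith
  by_cases hcase : c / 2 ≤ μ.real (G \ H)
  · -- Case (i): the lower tail `{mass ≤ E/2}` has probability ≥ c/2
    have hsub : G \ H ⊆ {ω | mass ω ≤ μ[mass] / 2} := by
      intro ω hω
      have h2 : ¬ (E / 2 < mass ω) := hω.2
      show mass ω ≤ E / 2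
      exact not_lt.1 h2
    have htail : c / 2 ≤ μ.real {ω | mass ω ≤ μ[mass] / 2} :=
      hcase.trans (measureReal_mono hsub)
    have hcheb := div_four_mul_sq_integral_le_variance_of_lowerTail
      (memLp_two_sum_indicator_one μ B A fun x _ => hA x) hE0 htail
    calc min c₁ 1 * c / (8 * (M + 1)) * E ^ 2 ≤ c / 2 / 4 * E ^ 2 :=
          mul_le_mul_of_nonneg_right hconst1 (sq_nonneg _)
      _ ≤ Var[mass; μ] := hcheb
  · -- Case (ii): `G ∩ H` has probability ≥ c/2
    have hGH : c / 2 ≤ μ.real (G ∩ H) := by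
      push Not at hcase
      linarith
    -- pointwise: 1_{G ∩ H} (E/2)² ≤ (M+1) · sqm
    have hpt : ∀ ω, (G ∩ H).indicator (fun _ => (E / 2) ^ 2) ω ≤ ((M : ℝ) + 1) * sqm ω := by
      intro ω
      by_cases hω : ω ∈ G ∩ H
      · rw [Set.indicator_of_mem hω]
        have h1 : (E / 2) ^ 2 ≤ mass ω ^ 2 :=
          pow_le_pow_left₀ (by positivity) (le_of_lt hω.2) 2
        have h2 : mass ω ^ 2 ≤ M * sqm ω :=
          sq_sum_indicator_le B A C M ω (fun x hx => hrefl x hx ω) (fun x y => hsymm x y ω)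
            (fun x y z => htrans x y z ω) (hGsub hω.1)
        have h3 : (M : ℝ) * sqm ω ≤ ((M : ℝ) + 1) * sqm ω :=
          mul_le_mul_of_nonneg_right (by linarith) (hsqm0 ω)
        linarith
      · rw [Set.indicator_of_notMem hω]
        exact mul_nonneg (by positivity) (hsqm0 ω)
    have hGHm : MeasurableSet (G ∩ H) := hGm.inter hHm
    have hint : (E / 2) ^ 2 * μ.real (G ∩ H) ≤ ((M : ℝ) + 1) * ∫ ω, sqm ω ∂μ := by
      have h1 : ∫ ω, (G ∩ H).indicator (fun _ => (E / 2) ^ 2) ω ∂μ =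
          (E / 2) ^ 2 * μ.real (G ∩ H) := by
        rw [integral_indicator_const _ hGHm, smul_eq_mul, mul_comm]
      have h2 : ∫ ω, (G ∩ H).indicator (fun _ => (E / 2) ^ 2) ω ∂μ ≤
          ∫ ω, ((M : ℝ) + 1) * sqm ω ∂μ :=
        integral_mono ((integrable_const _).indicator hGHm) (hsqm_int.const_mul _) hpt
      rw [h1, integral_const_mul] at h2
      exact h2
    have hQ : (E / 2) ^ 2 * (c / 2) ≤ ((M : ℝ) + 1) * ∫ ω, sqm ω ∂μ :=
      (mul_le_mul_of_nonneg_left hGH (sq_nonneg _)).trans hint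
    have hQ' : (E / 2) ^ 2 * (c / 2) / ((M : ℝ) + 1) ≤ ∫ ω, sqm ω ∂μ := by
      rw [div_le_iff₀ (by positivity)]
      linarith
    rw [hsqm_mean] at hQ'
    calc min c₁ 1 * c / (8 * (M + 1)) * E ^ 2
        = min c₁ 1 * ((E / 2) ^ 2 * (c / 2) / ((M : ℝ) + 1)) := by
          field_simp
          ring
      _ ≤ c₁ * ((E / 2) ^ 2 * (c / 2) / ((M : ℝ) + 1)) :=
          mul_le_mul_of_nonneg_right hminc (by positivity)
      _ ≤ c₁ * ∑ x ∈ B, ∑ y ∈ B, μ.real (A x ∩ C x y) := mul_le_mul_of_nonneg_left hQ' hc₁.le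
      _ ≤ Var[mass; μ] := hVar

end Abstract

/-! ### The in-box connection events of `ℤ^d` form an equivalence relation on `B(n)` -/

variable {d : ℕ}

/-- `x ↔ x` inside `B(2n)` for `x ∈ B(n)`. -/
theorem openConnIn_box_refl {n : ℕ} {x : Site d} (hx : x ∈ box d n) (ω : BondConfig (Site d)) :
    ω ∈ openConnIn (↑(box d (2 * n)) : Set (Site d)) x x :=
  ⟨Finset.mem_coe.2 (box_mono d (by omega) hx), Finset.mem_coe.2 (box_mono d (by omega) hx),
    SimpleGraph.Reachable.refl _⟩

end Helpers

open Helpers in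
/-- **`PercNonSelfAveraging.ArmMassNSAOfSplit` (stmt-CriticalPhenomena-18330), settled — the split of
`ArmMassNSA` (stmt-CriticalPhenomena-7058):** `ClusterMassAnticoncentration → NonProliferation → ArmMassNSA`.
The first hypothesis is the squared-cluster-moment lower bound
`c₁ Σ_{x,y∈B(n)} P_{p_c}(x ↔ ∂⁻B(2n) ∧ x ↔ y, inside B(2n)) ≤ Var(M_n)` for all large `n`; the second is
VERBATIM the crux `NonProliferation` (stmt-CriticalPhenomena-4444: at most `M` spanning box-clusters with
probability `≥ c` along infinitely many `n`).  At a common good scale the two-case estimate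
`variance_lower_of_fewClusters` gives `Var(M_n) ≥ (min c₁ 1) c / (8(M+1)) · (E M_n)²`.  No FKG, BK or
independence is used. -/
theorem armMassNSAOfSplit_proof :
    Summit.CriticalPhenomena.PercolationContinuityZ3.Theses.PercNonSelfAveraging.ArmMassNSAOfSplit := by
  intro hA hNP
  unfold Summit.CriticalPhenomena.PercolationContinuityZ3.Theses.PercNonSelfAveraging.ArmMassNSA
  obtain ⟨c₁, hc₁, hev⟩ := hA
  obtain ⟨M, c, hc, hfreq⟩ := hNP
  refine ⟨min c₁ 1 * c / (8 * (M + 1)), by positivity, ?_⟩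
  refine (hfreq.and_eventually hev).mono ?_
  rintro n ⟨hG, hAn⟩
  exact variance_lower_of_fewClusters (box 3 n)
    (fun x => {ω | ∃ z ∈ innerBoundary (zdGraph 3) (box 3 (2 * n)),
      ω ∈ openConnIn (↑(box 3 (2 * n)) : Set (Site 3)) x z})
    (fun x y => openConnIn (↑(box 3 (2 * n)) : Set (Site 3)) x y)
    (bondPercolation (zdGraph 3) (criticalProbI 3))
    (fun x => measurableSet_toBdry (2 * n) x) (fun x y => DCT16.measurableSet_openConnIn _ x y)
    (fun x hx ω => openConnIn_box_refl hx ω) (fun x y ω h => ⟨h.2.1, h.1, h.2.2.symm⟩)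
    (fun x y z ω h h' => ⟨h.1, h'.2.1, h.2.2.trans h'.2.2⟩) M
    (MeanCauchySchwarz.measurableSet_spanningFamily 3 n (2 * n) M).compl (fun ω hω => hω)
    hc hc₁ hG hAn

end Summit.CriticalPhenomena.PercolationContinuityZ3.Theorems.ArmMassNSASplit

end
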